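import Mathlib
import HarnessLib
import Summits.Ventures.LatticeQCDFlow.Scoring.ReversibleVariationalVariance
import Summits.Ventures.LatticeQCDFlow.Scoring.DoeblinPowerGeometricEnvelope
import Summits.Ventures.LatticeQCDFlow.Scoring.BatchMeansTauInt

/-!
# PESKUN–TIERNEY ORDERING on a general state space, typed: of two `π`-reversible kernels, the one with
# the larger Dirichlet form — in particular the one that moves MORE off the diagonal — has the smaller
# Green–Kubo variance for EVERY bounded observable; and the comparison inequality with a factor `c`:
# `κ₂ ≤ c κ₁` off the diagonal `⇒ σ²_f(κ₁) + Var_π f ≤ c (σ²_f(κ₂) + Var_π f)`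

HONEST FRAMING: exact (Metropolis-corrected) sampling algorithms for lattice gauge theory;
figures of merit are autocorrelation/cost numbers at stated couplings and volumes; no
continuum-physics claim.

Venture `LatticeQCDFlow` (cell pub-lqcd), topic `Scoring`; FANOUT row 8 (`s0-cpn-nemc`, GEN-23).
NEW WORK of the cell, not a published result; no definition is introduced; nothing is cited as a
fact.  Two Markov kernels `κ₁, κ₂`, both `π`-reversible (same probability law `π`), each with a
geometric sup-norm envelope (`0 ≤ ρᵢ < 1`; so each has bounded Poisson solutions and a Green–Kubo
variance `σ²_f(κᵢ) = ∫ f̄² dπ + 2 Σ' k, ∫ f̄ (kop κᵢ)^[k+1] f̄ dπ` for every bounded `f`, `f̄ = f − πf`).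
The variational principle of `Scoring/ReversibleVariationalVariance`
(`σ²_f(κ) ≥ 4⟨f̄, g⟩ − 2𝓔_κ(g) − ‖f̄‖²` for every bounded trial `g`, with equality at the Poisson
solution; `𝓔_κ(g) = ⟨g, g − kop κ g⟩_π`) makes the comparison theorem a two-line consequence:
(1) **DIRICHLET DOMINATION**: if `𝓔_{κ₂}(g) ≤ 𝓔_{κ₁}(g)` for every bounded measurable `g`, then
`σ²_f(κ₁) ≤ σ²_f(κ₂)` for every bounded `f` (test `κ₂`'s bound with `κ₁`'s Poisson solution `h₁`:
`σ²(κ₂) ≥ 4⟨f̄, h₁⟩ − 2𝓔₂(h₁) − ‖f̄‖² ≥ 4⟨f̄, h₁⟩ − 2𝓔₁(h₁) − ‖f̄‖² = σ²(κ₁)`);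
(2) **OFF-DIAGONAL DOMINATION ⇒ DIRICHLET DOMINATION**: since `𝓔_κ(g) = ½ ∫∫ (g y − g x)² κ(x, dy) π(dx)`
(`Scoring/ReversibleVariationalVariance.kopDirichlet_eq_half_meanSqJump`) and the integrand vanishes on
the diagonal, `κ₂(x, B) ≤ κ₁(x, B)` for every measurable `B ∌ x` and every `x` gives `𝓔₂ ≤ 𝓔₁`;
(3) hence **PESKUN–TIERNEY**: `κ₁ ≥ κ₂` off the diagonal `⇒ σ²_f(κ₁) ≤ σ²_f(κ₂)` for every bounded `f`
— a reversible sampler that proposes/accepts more moves is never worse, observable by observable;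
(4) with a FACTOR: `𝓔₂ ≤ c 𝓔₁` (in particular `κ₂ ≤ c κ₁` off the diagonal, `c > 0`) gives, testing with
`h₁/c`, `σ²_f(κ₁) + Var_π f ≤ c (σ²_f(κ₂) + Var_π f)`, i.e. `2τ_int,f(κ₁) + 1 ≤ c (2τ_int,f(κ₂) + 1)` —
transition rates comparable within a factor give integrated autocorrelation times comparable within
that factor (the comparison inequality used to transfer bounds between algorithms).  Reading (value-free): the typed rule for comparing exact samplers sharing a target (e.g. Barker vs
Metropolis acceptance at the same proposal): it orders `σ²_f`, hence `τ_int,f`, for ALL bounded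
observables at once, with no spectral theory.  Printed counterparts
NAMED ONLY: Peskun, *Optimum Monte-Carlo sampling using Markov chains*, Biometrika 60 (1973) (finite
state space); Tierney, *A note on Metropolis–Hastings kernels for general state spaces*, Ann. Appl.
Probab. 8 (1998), Thm 4 (general state space, via the Dirichlet-form/spectral route); Caracciolo–
Pelissetto–Sokal 1990 (Dirichlet-form orderings) — nothing is cited as a fact.

## Content (`π` a probability law; `κ₁, κ₂` `π`-reversible with envelopes `(A₁, ρ₁)`, `(A₂, ρ₂)`;
## `|f| ≤ C`, `|g| ≤ C_g` measurable)

* **`greenKubo_le_of_kopDirichlet_le_of_isReversible`** — `(∀ g, 𝓔₂(g) ≤ 𝓔₁(g)) ⇒ σ²_f(κ₁) ≤ σ²_f(κ₂)`;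
* **`kopDirichlet_le_of_offDiag_le`** (`[MeasurableSingletonClass Ω]`, `π`-invariant kernels) and
  **`greenKubo_le_of_offDiag_le_of_isReversible`** — PESKUN–TIERNEY from off-diagonal domination;
* **`greenKubo_add_variance_le_mul_of_kopDirichlet_le_mul_of_isReversible`** — `𝓔₂ ≤ c 𝓔₁`, `c > 0`
  `⇒ σ²_f(κ₁) + Var_π f ≤ c (σ²_f(κ₂) + Var_π f)`; `kopDirichlet_le_mul_of_offDiag_le_mul` —
  `κ₂(x,B) ≤ c κ₁(x,B)` off the diagonal `⇒ 𝓔₂ ≤ c 𝓔₁`;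
  **`greenKubo_add_variance_le_mul_of_offDiag_le_mul_of_isReversible`** — the comparison inequality;
* `tauInt_le_of_offDiag_le_of_isReversible` — the same as `τ_int,f(κ₁) ≤ τ_int,f(κ₂)` (`Scoring.tauInt`,
  `Var_π f ≠ 0`);
* `greenKubo_le_of_offDiag_le_of_nHit_of_isReversible` — Peskun–Tierney with the two kernels'
  Doeblin-power certificates in place of the envelopes.

NOT CLAIMED: non-reversible kernels; the converse; strictness; unbounded observables; any concrete
pair of engine kernels; any number of ours.
-/

noncomputable section

namespace Summit.Ventures.LatticeQCDFlow.Scoring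

open MeasureTheory ProbabilityTheory Filter Finset Preorder Literature.Probability.MarkovChains
open scoped ENNReal Topology

variable {Ω : Type*} [MeasurableSpace Ω]

/-- `x ↦ ∫ (g y − g x)² dκ(x,·)` is measurable for a Markov kernel and measurable `g`. -/
private theorem meanSqJump_measurable (κ : Kernel Ω Ω) [IsMarkovKernel κ] {g : Ω → ℝ}
    (hg : Measurable g) : Measurable fun x => ∫ y, (g y - g x) ^ 2 ∂(κ x) := by
  have hF : Measurable (Function.uncurry fun (x y : Ω) => (g y - g x) ^ 2) :=
    ((hg.comp measurable_snd).sub (hg.comp measurable_fst)).pow_const 2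
  exact (hF.stronglyMeasurable.integral_kernel_prod_right' (κ := κ)).measurable

/-- `|∫ (g y − g x)² dκ(x,·)| ≤ (2 C_g)²` for `|g| ≤ C_g`. -/
private theorem meanSqJump_abs_le (κ : Kernel Ω Ω) [IsMarkovKernel κ] {g : Ω → ℝ}
    {Cg : ℝ} (hCg : ∀ x, |g x| ≤ Cg) (x : Ω) :
    |∫ y, (g y - g x) ^ 2 ∂(κ x)| ≤ (Cg + Cg) ^ 2 := by
  rw [abs_of_nonneg (integral_nonneg fun y => sq_nonneg _)]
  calc ∫ y, (g y - g x) ^ 2 ∂(κ x) ≤ ∫ _y, (Cg + Cg) ^ 2 ∂(κ x) :=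
        integral_mono_of_nonneg (ae_of_all _ fun y => sq_nonneg _) (integrable_const _)
          (ae_of_all _ fun y => by
            calc (g y - g x) ^ 2 = |g y - g x| ^ 2 := (sq_abs _).symm
              _ ≤ (Cg + Cg) ^ 2 := pow_le_pow_left₀ (abs_nonneg _)
                  ((abs_sub _ _).trans (add_le_add (hCg y) (hCg x))) 2)
    _ = (Cg + Cg) ^ 2 := by rw [integral_const, probReal_univ, one_smul]

section TwoKernels

variable {κ₁ κ₂ : Kernel Ω Ω} [IsMarkovKernel κ₁] [IsMarkovKernel κ₂] {π : Measure Ω}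
  [IsProbabilityMeasure π] {A₁ ρ₁ A₂ ρ₂ : ℝ}

/-- **DIRICHLET DOMINATION ORDERS THE VARIANCES.**  `κ₁, κ₂` `π`-reversible with geometric envelopes;
if `∫ g (g − kop κ₂ g) dπ ≤ ∫ g (g − kop κ₁ g) dπ` for every bounded measurable `g`, then
`σ²_f(κ₁) ≤ σ²_f(κ₂)` for every `|f| ≤ C` measurable. -/
theorem greenKubo_le_of_kopDirichlet_le_of_isReversible
    (hrev₁ : Kernel.IsReversible κ₁ π) (hrev₂ : Kernel.IsReversible κ₂ π)
    (henv₁ : ∀ (g : Ω → ℝ), Measurable g → ∀ (Cg : ℝ), (∀ x, |g x| ≤ Cg) →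
      ∀ (t : ℕ) (x : Ω), |(kop κ₁)^[t] g x - ∫ y, g y ∂π| ≤ 2 * Cg * (A₁ * ρ₁ ^ t))
    (hρ₁0 : 0 ≤ ρ₁) (hρ₁1 : ρ₁ < 1)
    (henv₂ : ∀ (g : Ω → ℝ), Measurable g → ∀ (Cg : ℝ), (∀ x, |g x| ≤ Cg) →
      ∀ (t : ℕ) (x : Ω), |(kop κ₂)^[t] g x - ∫ y, g y ∂π| ≤ 2 * Cg * (A₂ * ρ₂ ^ t))
    (hρ₂0 : 0 ≤ ρ₂) (hρ₂1 : ρ₂ < 1)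
    (hdom : ∀ (g : Ω → ℝ), Measurable g → ∀ (Cg : ℝ), (∀ x, |g x| ≤ Cg) →
      ∫ y, g y * (g y - kop κ₂ g y) ∂π ≤ ∫ y, g y * (g y - kop κ₁ g y) ∂π)
    {f : Ω → ℝ} (hf : Measurable f) {C : ℝ} (hC : ∀ x, |f x| ≤ C) :
    (∫ y, (f y - ∫ z, f z ∂π) ^ 2 ∂π)
        + 2 * ∑' k, ∫ y, (f y - ∫ z, f z ∂π) * (kop κ₁)^[k + 1] (fun y => f y - ∫ z, f z ∂π) y ∂π
      ≤ (∫ y, (f y - ∫ z, f z ∂π) ^ 2 ∂π)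
        + 2 * ∑' k, ∫ y, (f y - ∫ z, f z ∂π) * (kop κ₂)^[k + 1] (fun y => f y - ∫ z, f z ∂π) y ∂π := by
  obtain ⟨h, hh, hCh, hpois⟩ := poisson_exists_of_geometricEnvelope henv₁ hρ₁0 hρ₁1 hf hC
  have heq := greenKubo_eq_variational_at_poisson hrev₁.invariant henv₁ hρ₁0 hρ₁1 hf hC hh hCh hpois
  have hvar := greenKubo_ge_variational_of_isReversible hrev₂ henv₂ hρ₂0 hρ₂1 hf hC hh hCh
  have hd := hdom h hh _ hCh
  rw [← heq]
  linarith

variable [MeasurableSingletonClass Ω]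

/-- **OFF-DIAGONAL DOMINATION IMPLIES DIRICHLET DOMINATION**: `κ₁, κ₂` `π`-invariant, `κ₂(x, B) ≤ κ₁(x, B)`
for every `x` and every measurable `B` with `x ∉ B`; then `∫ g (g − kop κ₂ g) dπ ≤ ∫ g (g − kop κ₁ g) dπ`
for every bounded measurable `g` (the Dirichlet form is `½ ∫∫ (g y − g x)² κ(x, dy) π(dx)` and the
integrand vanishes at `y = x`). -/
theorem kopDirichlet_le_of_offDiag_le (hπ₁ : Kernel.Invariant κ₁ π) (hπ₂ : Kernel.Invariant κ₂ π)
    (hoff : ∀ (x : Ω) (B : Set Ω), MeasurableSet B → x ∉ B → κ₂ x B ≤ κ₁ x B)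
    {g : Ω → ℝ} (hg : Measurable g) {Cg : ℝ} (hCg : ∀ x, |g x| ≤ Cg) :
    ∫ y, g y * (g y - kop κ₂ g y) ∂π ≤ ∫ y, g y * (g y - kop κ₁ g y) ∂π := by
  rw [kopDirichlet_eq_half_meanSqJump κ₁ hπ₁ hg hCg, kopDirichlet_eq_half_meanSqJump κ₂ hπ₂ hg hCg]
  refine mul_le_mul_of_nonneg_left ?_ (by norm_num)
  -- pointwise in `x`: `∫ (g y − g x)² dκ₂(x) ≤ ∫ (g y − g x)² dκ₁(x)` since the integrand vanishes at `x`
  have hφm : ∀ x, Measurable fun y => (g y - g x) ^ 2 := fun x => (hg.sub_const _).pow_const 2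
  have hφb : ∀ x y, |(g y - g x) ^ 2| ≤ (Cg + Cg) ^ 2 := fun x y => by
    rw [abs_pow]
    exact pow_le_pow_left₀ (abs_nonneg _) ((abs_sub _ _).trans (add_le_add (hCg y) (hCg x))) 2
  have hpt : ∀ x, ∫ y, (g y - g x) ^ 2 ∂(κ₂ x) ≤ ∫ y, (g y - g x) ^ 2 ∂(κ₁ x) := by
    intro x
    -- restrict both integrals to `{x}ᶜ`, where `κ₂ x ≤ κ₁ x`
    have hS : MeasurableSet ({x}ᶜ : Set Ω) := (measurableSet_singleton x).compl
    have hvan : ∀ (μ : Measure Ω), ∫ y, (g y - g x) ^ 2 ∂μ = ∫ y in {x}ᶜ, (g y - g x) ^ 2 ∂μ := by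
      intro μ
      rw [← integral_indicator hS]
      refine integral_congr_ae (ae_of_all _ fun y => ?_)
      by_cases hy : y = x
      · subst hy; simp
      · rw [Set.indicator_of_mem (by simpa using hy)]
    rw [hvan (κ₂ x), hvan (κ₁ x)]
    have hle : (κ₂ x).restrict {x}ᶜ ≤ (κ₁ x).restrict {x}ᶜ := by
      refine Measure.le_iff.2 fun B hB => ?_
      rw [Measure.restrict_apply hB, Measure.restrict_apply hB]
      exact hoff x (B ∩ {x}ᶜ) (hB.inter hS) (by simp)
    exact integral_mono_measure hle (ae_of_all _ fun y => sq_nonneg _)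
      ((integrable_of_bounded (κ₁ x) (hφm x) (hφb x)).restrict)
  exact integral_mono (integrable_of_bounded π (meanSqJump_measurable κ₂ hg)
    (meanSqJump_abs_le κ₂ hCg)) (integrable_of_bounded π (meanSqJump_measurable κ₁ hg)
    (meanSqJump_abs_le κ₁ hCg)) hpt

/-- **PESKUN–TIERNEY ORDERING.**  `κ₁, κ₂` `π`-reversible with geometric envelopes on a space with
measurable singletons; if `κ₂(x, B) ≤ κ₁(x, B)` for every `x` and every measurable `B ∌ x` (`κ₁` moves at
least as much as `κ₂` off the diagonal), then `σ²_f(κ₁) ≤ σ²_f(κ₂)` for every `|f| ≤ C` measurable. -/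
theorem greenKubo_le_of_offDiag_le_of_isReversible
    (hrev₁ : Kernel.IsReversible κ₁ π) (hrev₂ : Kernel.IsReversible κ₂ π)
    (henv₁ : ∀ (g : Ω → ℝ), Measurable g → ∀ (Cg : ℝ), (∀ x, |g x| ≤ Cg) →
      ∀ (t : ℕ) (x : Ω), |(kop κ₁)^[t] g x - ∫ y, g y ∂π| ≤ 2 * Cg * (A₁ * ρ₁ ^ t))
    (hρ₁0 : 0 ≤ ρ₁) (hρ₁1 : ρ₁ < 1)
    (henv₂ : ∀ (g : Ω → ℝ), Measurable g → ∀ (Cg : ℝ), (∀ x, |g x| ≤ Cg) →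
      ∀ (t : ℕ) (x : Ω), |(kop κ₂)^[t] g x - ∫ y, g y ∂π| ≤ 2 * Cg * (A₂ * ρ₂ ^ t))
    (hρ₂0 : 0 ≤ ρ₂) (hρ₂1 : ρ₂ < 1)
    (hoff : ∀ (x : Ω) (B : Set Ω), MeasurableSet B → x ∉ B → κ₂ x B ≤ κ₁ x B)
    {f : Ω → ℝ} (hf : Measurable f) {C : ℝ} (hC : ∀ x, |f x| ≤ C) :
    (∫ y, (f y - ∫ z, f z ∂π) ^ 2 ∂π)
        + 2 * ∑' k, ∫ y, (f y - ∫ z, f z ∂π) * (kop κ₁)^[k + 1] (fun y => f y - ∫ z, f z ∂π) y ∂π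
      ≤ (∫ y, (f y - ∫ z, f z ∂π) ^ 2 ∂π)
        + 2 * ∑' k, ∫ y, (f y - ∫ z, f z ∂π) * (kop κ₂)^[k + 1] (fun y => f y - ∫ z, f z ∂π) y ∂π :=
  greenKubo_le_of_kopDirichlet_le_of_isReversible hrev₁ hrev₂ henv₁ hρ₁0 hρ₁1 henv₂ hρ₂0 hρ₂1
    (fun _ hg _ hCg => kopDirichlet_le_of_offDiag_le hrev₁.invariant hrev₂.invariant hoff hg hCg) hf hC

/-! ### The comparison inequality with a constant (Caracciolo–Pelissetto–Sokal) -/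

omit [MeasurableSingletonClass Ω] in
/-- **DIRICHLET DOMINATION UP TO A FACTOR.**  `κ₁, κ₂` `π`-reversible with geometric envelopes, `0 < c`;
if `∫ g (g − kop κ₂ g) dπ ≤ c · ∫ g (g − kop κ₁ g) dπ` for every bounded measurable `g` (`κ₂` dissipates at
most `c` times as fast as `κ₁`), then for every `|f| ≤ C` measurable
`σ²_f(κ₁) + Var_π f ≤ c · (σ²_f(κ₂) + Var_π f)`, i.e. `2τ_int,f(κ₁) + 1 ≤ c (2τ_int,f(κ₂) + 1)`
(test `κ₂`'s variational bound with `h₁/c`). -/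
theorem greenKubo_add_variance_le_mul_of_kopDirichlet_le_mul_of_isReversible
    (hrev₁ : Kernel.IsReversible κ₁ π) (hrev₂ : Kernel.IsReversible κ₂ π)
    (henv₁ : ∀ (g : Ω → ℝ), Measurable g → ∀ (Cg : ℝ), (∀ x, |g x| ≤ Cg) →
      ∀ (t : ℕ) (x : Ω), |(kop κ₁)^[t] g x - ∫ y, g y ∂π| ≤ 2 * Cg * (A₁ * ρ₁ ^ t))
    (hρ₁0 : 0 ≤ ρ₁) (hρ₁1 : ρ₁ < 1)
    (henv₂ : ∀ (g : Ω → ℝ), Measurable g → ∀ (Cg : ℝ), (∀ x, |g x| ≤ Cg) →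
      ∀ (t : ℕ) (x : Ω), |(kop κ₂)^[t] g x - ∫ y, g y ∂π| ≤ 2 * Cg * (A₂ * ρ₂ ^ t))
    (hρ₂0 : 0 ≤ ρ₂) (hρ₂1 : ρ₂ < 1) {c : ℝ} (hc : 0 < c)
    (hdom : ∀ (g : Ω → ℝ), Measurable g → ∀ (Cg : ℝ), (∀ x, |g x| ≤ Cg) →
      ∫ y, g y * (g y - kop κ₂ g y) ∂π ≤ c * ∫ y, g y * (g y - kop κ₁ g y) ∂π)
    {f : Ω → ℝ} (hf : Measurable f) {C : ℝ} (hC : ∀ x, |f x| ≤ C) :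
    (∫ y, (f y - ∫ z, f z ∂π) ^ 2 ∂π)
        + 2 * ∑' k, ∫ y, (f y - ∫ z, f z ∂π) * (kop κ₁)^[k + 1] (fun y => f y - ∫ z, f z ∂π) y ∂π
        + ∫ y, (f y - ∫ z, f z ∂π) ^ 2 ∂π
      ≤ c * ((∫ y, (f y - ∫ z, f z ∂π) ^ 2 ∂π)
        + 2 * ∑' k, ∫ y, (f y - ∫ z, f z ∂π) * (kop κ₂)^[k + 1] (fun y => f y - ∫ z, f z ∂π) y ∂π
        + ∫ y, (f y - ∫ z, f z ∂π) ^ 2 ∂π) := by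
  obtain ⟨h, hh, hCh, hpois⟩ := poisson_exists_of_geometricEnvelope henv₁ hρ₁0 hρ₁1 hf hC
  have heq := greenKubo_eq_variational_at_poisson hrev₁.invariant henv₁ hρ₁0 hρ₁1 hf hC hh hCh hpois
  -- trial function `g = c⁻¹ h` in `κ₂`'s bound
  have hgm : Measurable fun y => c⁻¹ * h y := hh.const_mul _
  have hCg : ∀ x, |c⁻¹ * h x| ≤ |c⁻¹| * (4 * C * A₁ / (1 - ρ₁)) := fun x => by
    rw [abs_mul]; exact mul_le_mul_of_nonneg_left (hCh x) (abs_nonneg _)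
  have hvar := greenKubo_ge_variational_of_isReversible hrev₂ henv₂ hρ₂0 hρ₂1 hf hC hgm hCg
  have hd := hdom (fun y => c⁻¹ * h y) hgm _ hCg
  -- `kop κ (c⁻¹ h) = c⁻¹ kop κ h`
  have hK : ∀ (κ : Kernel Ω Ω) (y : Ω), kop κ (fun z => c⁻¹ * h z) y = c⁻¹ * kop κ h y := fun κ y => by
    unfold kop; exact integral_const_mul _ _
  have e1 : ∫ y, (f y - ∫ z, f z ∂π) * (c⁻¹ * h y) ∂π = c⁻¹ * ∫ y, (f y - ∫ z, f z ∂π) * h y ∂π := by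
    rw [← integral_const_mul]; exact integral_congr_ae (ae_of_all _ fun y => by ring)
  have e2 : ∀ (κ : Kernel Ω Ω), ∫ y, (c⁻¹ * h y) * ((c⁻¹ * h y) - kop κ (fun z => c⁻¹ * h z) y) ∂π
      = c⁻¹ ^ 2 * ∫ y, h y * (h y - kop κ h y) ∂π := fun κ => by
    rw [← integral_const_mul]
    exact integral_congr_ae (ae_of_all _ fun y => by simp only [hK κ y]; ring)
  rw [e1, e2 κ₂] at hvar
  rw [e2 κ₂, e2 κ₁] at hd
  rw [← heq]
  -- `hd : c⁻² 𝓔₂(h) ≤ c · c⁻² 𝓔₁(h)`; `hvar : 4 c⁻¹ ⟨f̄,h⟩ − 2 c⁻² 𝓔₂(h) − v ≤ σ²₂`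
  set a := ∫ y, (f y - ∫ z, f z ∂π) * h y ∂π
  set E1 := ∫ y, h y * (h y - kop κ₁ h y) ∂π
  set E2 := ∫ y, h y * (h y - kop κ₂ h y) ∂π
  set v := ∫ y, (f y - ∫ z, f z ∂π) ^ 2 ∂π
  set σ2 := v + 2 * ∑' k, ∫ y, (f y - ∫ z, f z ∂π)
      * (kop κ₂)^[k + 1] (fun y => f y - ∫ z, f z ∂π) y ∂π
  have hc1 : c * c⁻¹ = 1 := mul_inv_cancel₀ hc.ne'
  -- multiply `hvar` by `c`: `4a − 2 c⁻¹ E2 − c v ≤ c σ2`, and `c⁻¹ E2 ≤ E1` from `hd`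
  have h1 : c * (4 * (c⁻¹ * a) - 2 * (c⁻¹ ^ 2 * E2) - v) ≤ c * σ2 :=
    mul_le_mul_of_nonneg_left hvar hc.le
  have h2 : c⁻¹ ^ 2 * E2 ≤ c * (c⁻¹ ^ 2 * E1) := hd
  have h2' : c * (c⁻¹ ^ 2 * E2) ≤ c * (c * (c⁻¹ ^ 2 * E1)) := mul_le_mul_of_nonneg_left h2 hc.le
  have e3 : c * (4 * (c⁻¹ * a) - 2 * (c⁻¹ ^ 2 * E2) - v)
      = 4 * a - 2 * (c * (c⁻¹ ^ 2 * E2)) - c * v := by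
    calc c * (4 * (c⁻¹ * a) - 2 * (c⁻¹ ^ 2 * E2) - v)
        = (c * c⁻¹) * (4 * a) - 2 * (c * (c⁻¹ ^ 2 * E2)) - c * v := by ring
      _ = 4 * a - 2 * (c * (c⁻¹ ^ 2 * E2)) - c * v := by rw [hc1, one_mul]
  have e4 : c * (c * (c⁻¹ ^ 2 * E1)) = E1 := by
    calc c * (c * (c⁻¹ ^ 2 * E1)) = (c * c⁻¹) * ((c * c⁻¹) * E1) := by ring
      _ = E1 := by rw [hc1, one_mul, one_mul]
  rw [e3] at h1
  rw [e4] at h2'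
  nlinarith [h1, h2']

/-- **OFF-DIAGONAL DOMINATION UP TO A FACTOR**: `κ₁, κ₂` `π`-invariant, `0 ≤ c`,
`κ₂(x, B) ≤ c · κ₁(x, B)` (as `ENNReal.ofReal c * κ₁ x B`) for all `x` and measurable `B ∌ x`; then
`∫ g (g − kop κ₂ g) dπ ≤ c · ∫ g (g − kop κ₁ g) dπ` for every bounded measurable `g`. -/
theorem kopDirichlet_le_mul_of_offDiag_le_mul (hπ₁ : Kernel.Invariant κ₁ π) (hπ₂ : Kernel.Invariant κ₂ π)
    {c : ℝ} (hc : 0 ≤ c)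
    (hoff : ∀ (x : Ω) (B : Set Ω), MeasurableSet B → x ∉ B → κ₂ x B ≤ ENNReal.ofReal c * κ₁ x B)
    {g : Ω → ℝ} (hg : Measurable g) {Cg : ℝ} (hCg : ∀ x, |g x| ≤ Cg) :
    ∫ y, g y * (g y - kop κ₂ g y) ∂π ≤ c * ∫ y, g y * (g y - kop κ₁ g y) ∂π := by
  rw [kopDirichlet_eq_half_meanSqJump κ₁ hπ₁ hg hCg, kopDirichlet_eq_half_meanSqJump κ₂ hπ₂ hg hCg,
    mul_left_comm]
  refine mul_le_mul_of_nonneg_left ?_ (by norm_num)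
  have hφm : ∀ x, Measurable fun y => (g y - g x) ^ 2 := fun x => (hg.sub_const _).pow_const 2
  have hφb : ∀ x y, |(g y - g x) ^ 2| ≤ (Cg + Cg) ^ 2 := fun x y => by
    rw [abs_pow]
    exact pow_le_pow_left₀ (abs_nonneg _) ((abs_sub _ _).trans (add_le_add (hCg y) (hCg x))) 2
  have hpt : ∀ x, ∫ y, (g y - g x) ^ 2 ∂(κ₂ x) ≤ c * ∫ y, (g y - g x) ^ 2 ∂(κ₁ x) := by
    intro x
    have hS : MeasurableSet ({x}ᶜ : Set Ω) := (measurableSet_singleton x).compl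
    have hvan : ∀ (μ : Measure Ω), ∫ y, (g y - g x) ^ 2 ∂μ = ∫ y in {x}ᶜ, (g y - g x) ^ 2 ∂μ := by
      intro μ
      rw [← integral_indicator hS]
      refine integral_congr_ae (ae_of_all _ fun y => ?_)
      by_cases hy : y = x
      · subst hy; simp
      · rw [Set.indicator_of_mem (by simpa using hy)]
    rw [hvan (κ₂ x), hvan (κ₁ x)]
    have hle : (κ₂ x).restrict {x}ᶜ ≤ (ENNReal.ofReal c • κ₁ x).restrict {x}ᶜ := by
      refine Measure.le_iff.2 fun B hB => ?_
      rw [Measure.restrict_apply hB, Measure.restrict_apply hB, Measure.smul_apply, smul_eq_mul]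
      exact hoff x (B ∩ {x}ᶜ) (hB.inter hS) (by simp)
    have hint : Integrable (fun y => (g y - g x) ^ 2) ((ENNReal.ofReal c • κ₁ x).restrict {x}ᶜ) :=
      ((integrable_of_bounded (κ₁ x) (hφm x) (hφb x)).smul_measure ENNReal.ofReal_ne_top).restrict
    calc ∫ y in {x}ᶜ, (g y - g x) ^ 2 ∂(κ₂ x)
        ≤ ∫ y in {x}ᶜ, (g y - g x) ^ 2 ∂(ENNReal.ofReal c • κ₁ x) :=
          integral_mono_measure hle (ae_of_all _ fun y => sq_nonneg _) hint
      _ = c * ∫ y in {x}ᶜ, (g y - g x) ^ 2 ∂(κ₁ x) := by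
          rw [Measure.restrict_smul, integral_smul_measure, ENNReal.toReal_ofReal hc, smul_eq_mul]
  calc ∫ x, (∫ y, (g y - g x) ^ 2 ∂(κ₂ x)) ∂π ≤ ∫ x, c * (∫ y, (g y - g x) ^ 2 ∂(κ₁ x)) ∂π :=
        integral_mono (integrable_of_bounded π (meanSqJump_measurable κ₂ hg)
          (meanSqJump_abs_le κ₂ hCg)) ((integrable_of_bounded π (meanSqJump_measurable κ₁ hg)
          (meanSqJump_abs_le κ₁ hCg)).const_mul c) hpt
    _ = c * ∫ x, (∫ y, (g y - g x) ^ 2 ∂(κ₁ x)) ∂π := integral_const_mul _ _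

/-- **THE COMPARISON INEQUALITY (Caracciolo–Pelissetto–Sokal form of Peskun–Tierney).**  `κ₁, κ₂`
`π`-reversible with geometric envelopes on a space with measurable singletons, `0 < c`, and
`κ₂(x, B) ≤ c · κ₁(x, B)` for every `x` and measurable `B ∌ x`; then for every `|f| ≤ C` measurable
`σ²_f(κ₁) + Var_π f ≤ c · (σ²_f(κ₂) + Var_π f)`. -/
theorem greenKubo_add_variance_le_mul_of_offDiag_le_mul_of_isReversible
    (hrev₁ : Kernel.IsReversible κ₁ π) (hrev₂ : Kernel.IsReversible κ₂ π)
    (henv₁ : ∀ (g : Ω → ℝ), Measurable g → ∀ (Cg : ℝ), (∀ x, |g x| ≤ Cg) →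
      ∀ (t : ℕ) (x : Ω), |(kop κ₁)^[t] g x - ∫ y, g y ∂π| ≤ 2 * Cg * (A₁ * ρ₁ ^ t))
    (hρ₁0 : 0 ≤ ρ₁) (hρ₁1 : ρ₁ < 1)
    (henv₂ : ∀ (g : Ω → ℝ), Measurable g → ∀ (Cg : ℝ), (∀ x, |g x| ≤ Cg) →
      ∀ (t : ℕ) (x : Ω), |(kop κ₂)^[t] g x - ∫ y, g y ∂π| ≤ 2 * Cg * (A₂ * ρ₂ ^ t))
    (hρ₂0 : 0 ≤ ρ₂) (hρ₂1 : ρ₂ < 1) {c : ℝ} (hc : 0 < c)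
    (hoff : ∀ (x : Ω) (B : Set Ω), MeasurableSet B → x ∉ B → κ₂ x B ≤ ENNReal.ofReal c * κ₁ x B)
    {f : Ω → ℝ} (hf : Measurable f) {C : ℝ} (hC : ∀ x, |f x| ≤ C) :
    (∫ y, (f y - ∫ z, f z ∂π) ^ 2 ∂π)
        + 2 * ∑' k, ∫ y, (f y - ∫ z, f z ∂π) * (kop κ₁)^[k + 1] (fun y => f y - ∫ z, f z ∂π) y ∂π
        + ∫ y, (f y - ∫ z, f z ∂π) ^ 2 ∂π
      ≤ c * ((∫ y, (f y - ∫ z, f z ∂π) ^ 2 ∂π)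
        + 2 * ∑' k, ∫ y, (f y - ∫ z, f z ∂π) * (kop κ₂)^[k + 1] (fun y => f y - ∫ z, f z ∂π) y ∂π
        + ∫ y, (f y - ∫ z, f z ∂π) ^ 2 ∂π) :=
  greenKubo_add_variance_le_mul_of_kopDirichlet_le_mul_of_isReversible hrev₁ hrev₂ henv₁ hρ₁0 hρ₁1
    henv₂ hρ₂0 hρ₂1 hc
    (fun _ hg _ hCg => kopDirichlet_le_mul_of_offDiag_le_mul hrev₁.invariant hrev₂.invariant hc.le hoff
      hg hCg) hf hC

/-! ### The same in the `τ_int` vocabulary -/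

/-- **PESKUN–TIERNEY FOR `τ_int`**: under the hypotheses of `greenKubo_le_of_offDiag_le_of_isReversible`
and `Var_π f ≠ 0`, `τ_int,f(κ₁) ≤ τ_int,f(κ₂)` on the tree's `Scoring.tauInt` of the normalised
autocovariances `autocov κᵢ π f̄ t / autocov κᵢ π f̄ 0` (`autocov κ π f̄ 0 = Var_π f` for both). -/
theorem tauInt_le_of_offDiag_le_of_isReversible
    (hrev₁ : Kernel.IsReversible κ₁ π) (hrev₂ : Kernel.IsReversible κ₂ π)
    (henv₁ : ∀ (g : Ω → ℝ), Measurable g → ∀ (Cg : ℝ), (∀ x, |g x| ≤ Cg) →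
      ∀ (t : ℕ) (x : Ω), |(kop κ₁)^[t] g x - ∫ y, g y ∂π| ≤ 2 * Cg * (A₁ * ρ₁ ^ t))
    (hρ₁0 : 0 ≤ ρ₁) (hρ₁1 : ρ₁ < 1)
    (henv₂ : ∀ (g : Ω → ℝ), Measurable g → ∀ (Cg : ℝ), (∀ x, |g x| ≤ Cg) →
      ∀ (t : ℕ) (x : Ω), |(kop κ₂)^[t] g x - ∫ y, g y ∂π| ≤ 2 * Cg * (A₂ * ρ₂ ^ t))
    (hρ₂0 : 0 ≤ ρ₂) (hρ₂1 : ρ₂ < 1)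
    (hoff : ∀ (x : Ω) (B : Set Ω), MeasurableSet B → x ∉ B → κ₂ x B ≤ κ₁ x B)
    {f : Ω → ℝ} (hf : Measurable f) {C : ℝ} (hC : ∀ x, |f x| ≤ C)
    (hvar : autocov κ₁ π (fun y => f y - ∫ z, f z ∂π) 0 ≠ 0) :
    tauInt (fun t => autocov κ₁ π (fun y => f y - ∫ z, f z ∂π) t
        / autocov κ₁ π (fun y => f y - ∫ z, f z ∂π) 0)
      ≤ tauInt (fun t => autocov κ₂ π (fun y => f y - ∫ z, f z ∂π) t
        / autocov κ₂ π (fun y => f y - ∫ z, f z ∂π) 0) := by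
  have h := greenKubo_le_of_offDiag_le_of_isReversible hrev₁ hrev₂ henv₁ hρ₁0 hρ₁1 henv₂ hρ₂0 hρ₂1 hoff
    hf hC
  -- `autocov κ π f̄ 0 = ∫ f̄² dπ` for both kernels
  have e0 : ∀ (κ : Kernel Ω Ω), autocov κ π (fun y => f y - ∫ z, f z ∂π) 0
      = ∫ y, (f y - ∫ z, f z ∂π) ^ 2 ∂π := fun κ => by rw [autocov_zero]
  have hV : 0 ≤ ∫ y, (f y - ∫ z, f z ∂π) ^ 2 ∂π := integral_nonneg fun y => sq_nonneg _
  have hV0 : 0 < ∫ y, (f y - ∫ z, f z ∂π) ^ 2 ∂π := by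
    rcases hV.eq_or_lt with h0 | h0
    · exact absurd (by rw [e0]; exact h0.symm) hvar
    · exact h0
  have e1 := two_mul_mul_tauInt_eq (γ := fun t => autocov κ₁ π (fun y => f y - ∫ z, f z ∂π) t) hvar
  have hvar2 : autocov κ₂ π (fun y => f y - ∫ z, f z ∂π) 0 ≠ 0 := by rw [e0]; exact hV0.ne'
  have e2 := two_mul_mul_tauInt_eq (γ := fun t => autocov κ₂ π (fun y => f y - ∫ z, f z ∂π) t) hvar2
  simp only [e0] at e1 e2 ⊢
  -- the Green–Kubo expressions are `C(0) + 2 Σ' C(t+1)` with `C(t+1)` the lag integrals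
  have eσ : ∀ (κ : Kernel Ω Ω), (∫ y, (f y - ∫ z, f z ∂π) ^ 2 ∂π)
      + 2 * ∑' t, autocov κ π (fun y => f y - ∫ z, f z ∂π) (t + 1)
      = (∫ y, (f y - ∫ z, f z ∂π) ^ 2 ∂π)
        + 2 * ∑' k, ∫ y, (f y - ∫ z, f z ∂π) * (kop κ)^[k + 1] (fun y => f y - ∫ z, f z ∂π) y ∂π :=
    fun κ => rfl
  rw [eσ κ₁] at e1
  rw [eσ κ₂] at e2
  -- divide `2 V τ₁ = σ²₁ ≤ σ²₂ = 2 V τ₂` by `2V > 0`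
  have : 2 * (∫ y, (f y - ∫ z, f z ∂π) ^ 2 ∂π) * tauInt (fun t => autocov κ₁ π (fun y => f y - ∫ z, f z ∂π) t
      / ∫ y, (f y - ∫ z, f z ∂π) ^ 2 ∂π)
      ≤ 2 * (∫ y, (f y - ∫ z, f z ∂π) ^ 2 ∂π) * tauInt (fun t => autocov κ₂ π (fun y => f y - ∫ z, f z ∂π) t
      / ∫ y, (f y - ∫ z, f z ∂π) ^ 2 ∂π) := by rw [e1, e2]; exact h
  exact le_of_mul_le_mul_left this (by positivity)

/-! ### Certificate form (Doeblin powers) -/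

/-- **PESKUN–TIERNEY IN CERTIFICATE FORM**: `κ₁, κ₂` `π`-reversible, each with an `m`-step Doeblin
certificate `(nHit κᵢ mᵢ)(x, ·) ≥ εᵢ νᵢ` (`0 < εᵢ ≤ 1`, `0 < mᵢ`), on a space with measurable singletons;
if `κ₂(x, B) ≤ κ₁(x, B)` for every `x` and measurable `B ∌ x` then `σ²_f(κ₁) ≤ σ²_f(κ₂)` for every
`|f| ≤ C` measurable. -/
theorem greenKubo_le_of_offDiag_le_of_nHit_of_isReversible
    (hrev₁ : Kernel.IsReversible κ₁ π) (hrev₂ : Kernel.IsReversible κ₂ π)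
    {m₁ : ℕ} {ε₁ : ℝ≥0∞} {ν₁ : Measure Ω} [IsProbabilityMeasure ν₁]
    (hmin₁ : ∀ x {B : Set Ω}, MeasurableSet B → ε₁ * ν₁ B ≤ Exactness.nHit κ₁ m₁ x B)
    (hε₁0 : 0 < ε₁) (hε₁1 : ε₁ ≤ 1) (hm₁ : 0 < m₁)
    {m₂ : ℕ} {ε₂ : ℝ≥0∞} {ν₂ : Measure Ω} [IsProbabilityMeasure ν₂]
    (hmin₂ : ∀ x {B : Set Ω}, MeasurableSet B → ε₂ * ν₂ B ≤ Exactness.nHit κ₂ m₂ x B)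
    (hε₂0 : 0 < ε₂) (hε₂1 : ε₂ ≤ 1) (hm₂ : 0 < m₂)
    (hoff : ∀ (x : Ω) (B : Set Ω), MeasurableSet B → x ∉ B → κ₂ x B ≤ κ₁ x B)
    {f : Ω → ℝ} (hf : Measurable f) {C : ℝ} (hC : ∀ x, |f x| ≤ C) :
    (∫ y, (f y - ∫ z, f z ∂π) ^ 2 ∂π)
        + 2 * ∑' k, ∫ y, (f y - ∫ z, f z ∂π) * (kop κ₁)^[k + 1] (fun y => f y - ∫ z, f z ∂π) y ∂π
      ≤ (∫ y, (f y - ∫ z, f z ∂π) ^ 2 ∂π)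
        + 2 * ∑' k, ∫ y, (f y - ∫ z, f z ∂π) * (kop κ₂)^[k + 1] (fun y => f y - ∫ z, f z ∂π) y ∂π := by
  obtain ⟨A₁', ρ₁', -, hρ₁0, hρ₁1, henv₁⟩ :=
    exists_geometricEnvelope_of_nHit hmin₁ hε₁0 hε₁1 hm₁ hrev₁.invariant
  obtain ⟨A₂', ρ₂', -, hρ₂0, hρ₂1, henv₂⟩ :=
    exists_geometricEnvelope_of_nHit hmin₂ hε₂0 hε₂1 hm₂ hrev₂.invariant
  exact greenKubo_le_of_offDiag_le_of_isReversible hrev₁ hrev₂ henv₁ hρ₁0 hρ₁1 henv₂ hρ₂0 hρ₂1 hoff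
    hf hC

end TwoKernels

end Summit.Ventures.LatticeQCDFlow.Scoring

end
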